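import Summits.QuantumFields.BalabanUV.T4Continuum.Support.NE3TowerBondVsSegment
import Summits.QuantumFields.BalabanUV.T4Continuum.Support.NE3TopRadiusLetters
import Summits.QuantumFields.BalabanUV.T4Continuum.Support.AveragingDeficitNearIdentity
import HarnessLib

/-!
# T⁴ programme, row NE7 — (154g) THE CORNER-OSCILLATION LETTER OF B8'S GAUGE IS `α̂ + O(δ)`: in the fibre `cavgIter L (k+1) U = 1`,
# `‖u₀(M(z+e_i)) − u₀(Mz)‖ ≤ M(e^{a₀} − 1) + 136(d+1)(d+4)·M²x` (`NE7CornerOscillationLetter`)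

Cell `pub-balaban`, lineage `t4-ne7-p2` (CRUX PROVER NE7 #2), gen 86; the residual letter of road (β′) ((154e)∕(154f)): the corner
oscillation `ω` of B8's gauge `u₀` (`U^{u₀} = vary 1 A₀ 1`, `‖A₀‖ ≤ a₀`) over a background `U` IN THE FIBRE of the iterated average
(`cavgIter L (k+1) U = 1`), in the multi-level small-field class (`SmallField U x`, `LevelSmall d L k x`, `L ≥ 2`).  THE BOUND:
`‖u₀(M(z+e_i)) − u₀(Mz)‖ ≤ M·(e^{a₀} − 1) + 8·17(d+1)(d+4)·(M²x)`, `M = L^{k+1}`: the first term is the straight `M`-segment holonomy of the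
representative `e^{A₀}` (M links, each within `e^{a₀} − 1` of `1`), the second is the straight `M`-segment holonomy of `U` from the corner,
which the fibre constraint pins to `1` up to the tree's k-FREE tower letter (`NE3TowerBondVsSegment.norm_cavgIter_sub_bseg_le_top`:
`‖cavgIter L (k+1) U − bseg (L^{k+1}) U‖ ≤ 8·loopRad(r_k)`; `NE3TopRadiusLetters.loopRad_iterate_le_of_levelSmall`: `≤ 17(d+1)(d+4)M²x`);
the two are tied by the gauge covariance of parallel transport (`hol_gaugeAct`): `u₀(M(z+e_i)) = hol(U^{u₀})⁻¹·u₀(Mz)·bseg M U z i`.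
In THE END's currencies (`a₀ = α̂∕M`, `x = δ∕M²`): `ω ≤ M(e^{α̂∕M} − 1) + 136(d+1)(d+4)δ ≈ α̂ + 136(d+1)(d+4)δ` — k-UNIFORM, as PRICING-NE7
§419 and `g85/HFLATTOP-MEMO.md` §3 anticipated («ω = O(α̂ + δ) generically»); so (154f)'s letter is discharged from THE END's own data.

HONEST FRAMING (page 1): [folklore] kinematics (gauge covariance of holonomy + the tree's tower-vs-segment letter), composition BY NAME;
nothing of Bałaban's is proved; (U, u₀, A₀) are HYPOTHESES (B8 Thm 2 TYPE); (APE) NOT proved; THE END unfiled; NE7 NOT PRINTED ∕ NOT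
PROVED; spine 0∕9; finite T⁴ rung (B)+1 — NOT infinite volume, NOT mass gap, NOT Clay.  No `sorry`.  PLACEMENT: our lemma,
under `Summits/QuantumFields/BalabanUV/`.
Continuum YM on T⁴ ⇐ BetaPertH ∧ nine spine estimates (0/9 proved); BetaPertH ⇐ (D1) ∧ (D4) ∧ CAP+tail; G-an2-4 gates asym, D1 and NE2/3/4.
-/

set_option autoImplicit false

open scoped BigOperators Matrix.Norms.L2Operator
open NormedSpace

namespace Summit.QuantumFields.BalabanUV.T4Continuum.NE7CornerOscillationLetter

open Literature.MathematicalPhysics.QuantumFieldTheory.Balaban1983to89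
open B7Prop1Explicit B7Prop2Explicit
open T4AveragingDeficitWall (IsUnitaryCfg SmallField vary)
open AveragingDeficitTwoLevelPrep (prop1Radius)
open AveragingDeficitMultiLevelPrep (cavgIter LevelSmall)
open AveragingDeficitBlockDensity (bseg)
open AveragingDeficitNearIdentity (norm_hol_sub_one_le_of_bonds)
open AveragingDeficitLocality (bondsOf)
open SpreadLift (loopRad)
open BlockAveragePushDirSplit (flat)
open NE3TowerBondVsSegment (norm_cavgIter_sub_bseg_le_top)
open NE3TopRadiusLetters (loopRad_iterate_le_of_levelSmall)

noncomputable section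

variable {d : ℕ} {n : Type*} [Fintype n] [DecidableEq n] [Nonempty n]

/-- **THE STRAIGHT CORNER-TO-CORNER HOLONOMY OF A FIBRE POINT IS NEAR `1`**: in the multi-level small-field class, if
`cavgIter L (k+1) U = 1` then `‖hol U (M•z) (seg i M) − 1‖ ≤ 136(d+1)(d+4)·(M²x)` (`M = L^{k+1}`, `L ≥ 2`) — the tree's tower-vs-segment
letter read at a flat top. [folklore] -/
theorem norm_bseg_sub_one_le_of_flatTop {L : ℕ} (hL : 2 ≤ L) (k : ℕ) {U : Site d → Fin d → (Matrix n n ℂ)ˣ} {x : ℝ}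
    (hUu : IsUnitaryCfg U) (hx : 0 ≤ x) (hs : LevelSmall d L k x) (hUx : SmallField U x)
    (hflatTopU : cavgIter L (k + 1) U = flat) (z : Site d) (i : Fin d) :
    ‖((bseg (L ^ (k + 1)) U z i : (Matrix n n ℂ)ˣ) : Matrix n n ℂ) - 1‖
      ≤ 136 * (((d : ℝ) + 1) * ((d : ℝ) + 4)) * (((L : ℝ) ^ (k + 1)) ^ 2 * x) := by
  have h1 := norm_cavgIter_sub_bseg_le_top hL k hUu hx hs hUx z i
  have h2 := loopRad_iterate_le_of_levelSmall (d := d) hL k hx hs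
  rw [hflatTopU] at h1
  simp only [flat, Units.val_one] at h1
  rw [norm_sub_rev] at h1
  linarith

/-- **THE CORNER-OSCILLATION LETTER.**  For a background `U` in the fibre (`cavgIter L (k+1) U = 1`) of the multi-level small-field class
(`L ≥ 2`) and a unitary gauge `u₀` with `U^{u₀} = vary 1 A₀ 1`, `‖A₀‖ ≤ a₀`:
`‖u₀(M(z+e_i)) − u₀(Mz)‖ ≤ M·(e^{a₀} − 1) + 136(d+1)(d+4)·(M²x)`, `M = L^{k+1}`. [folklore] -/
theorem corner_oscillation_le {L : ℕ} (hL : 2 ≤ L) (k : ℕ) {U : Site d → Fin d → (Matrix n n ℂ)ˣ} {x : ℝ}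
    (hUu : IsUnitaryCfg U) (hx : 0 ≤ x) (hs : LevelSmall d L k x) (hUx : SmallField U x)
    (hflatTopU : cavgIter L (k + 1) U = flat)
    {u₀ : Site d → (Matrix n n ℂ)ˣ} (hu₀ : ∀ y, u₀ y ∈ unitaryUnits (Matrix n n ℂ))
    {A₀ : Site d → Fin d → Matrix n n ℂ} (hgauge₀ : gaugeAct u₀ U = vary (flat (d := d) (n := n)) A₀ 1)
    {a₀ : ℝ} (ha₀ : ∀ (y : Site d) (κ : Fin d), ‖A₀ y κ‖ ≤ a₀) (z : Site d) (i : Fin d) :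
    ‖(u₀ (((L : ℤ) ^ (k + 1)) • (z + e i)) : Matrix n n ℂ) - u₀ (((L : ℤ) ^ (k + 1)) • z)‖
      ≤ (L : ℝ) ^ (k + 1) * (Real.exp a₀ - 1) + 136 * (((d : ℝ) + 1) * ((d : ℝ) + 4)) * (((L : ℝ) ^ (k + 1)) ^ 2 * x) := by
  letI : CStarAlgebra (Matrix n n ℂ) := {}
  have hMz : ((L ^ (k + 1) : ℕ) : ℤ) = (L : ℤ) ^ (k + 1) := by push_cast; ring
  -- the representative `E = U^{u₀}` is unitary with links `e^{A₀}` within `e^{a₀} − 1` of `1`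
  have hEu : IsUnitaryCfg (gaugeAct u₀ U) := fun y μ =>
    (unitaryUnits _).mul_mem ((unitaryUnits _).mul_mem (hu₀ y) (hUu y μ)) ((unitaryUnits _).inv_mem (hu₀ _))
  have hE1 : ∀ (y : Site d) (μ : Fin d), ‖((gaugeAct u₀ U y μ : (Matrix n n ℂ)ˣ) : Matrix n n ℂ) - 1‖ ≤ Real.exp a₀ - 1 := by
    intro y μ
    rw [hgauge₀]
    simp only [vary, flat, one_mul, Complex.ofReal_one, one_smul, val_expUnit]
    exact B7Transfer.norm_exp_sub_one_le_of_le _ (ha₀ y μ)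
  -- its straight `M`-segment holonomy from the corner
  set M : ℕ := L ^ (k + 1) with hMdef
  have hholE : ‖((hol (gaugeAct u₀ U) (((L : ℤ) ^ (k + 1)) • z) (seg i (M : ℤ)) : (Matrix n n ℂ)ˣ) : Matrix n n ℂ) - 1‖
      ≤ (L : ℝ) ^ (k + 1) * (Real.exp a₀ - 1) := by
    have h := norm_hol_sub_one_le_of_bonds hEu (β := Real.exp a₀ - 1) (((L : ℤ) ^ (k + 1)) • z) (seg i (M : ℤ))
      (fun b _ => hE1 b.1 b.2)
    have hlen : ((seg i (M : ℤ)).length : ℝ) = (L : ℝ) ^ (k + 1) := by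
      rw [length_seg, Int.natAbs_natCast, hMdef]; push_cast; ring
    rw [hlen] at h
    exact h
  -- gauge covariance of parallel transport: `hol E = u₀(Mz) · bseg M U z i · u₀(M(z+e_i))⁻¹`
  have hcov : hol (gaugeAct u₀ U) (((L : ℤ) ^ (k + 1)) • z) (seg i (M : ℤ))
      = u₀ (((L : ℤ) ^ (k + 1)) • z) * bseg M U z i * (u₀ (((L : ℤ) ^ (k + 1)) • (z + e i)))⁻¹ := by
    rw [hol_gaugeAct, disp_seg, bseg, hMdef, hMz, smul_add]
  -- hence `u₀(M(z+e_i)) = (hol E)⁻¹ · u₀(Mz) · bseg`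
  have hsolve : u₀ (((L : ℤ) ^ (k + 1)) • (z + e i))
      = (hol (gaugeAct u₀ U) (((L : ℤ) ^ (k + 1)) • z) (seg i (M : ℤ)))⁻¹ * u₀ (((L : ℤ) ^ (k + 1)) • z) * bseg M U z i := by
    rw [hcov]; group
  -- unitarity of the pieces
  have hbsegU : bseg M U z i ∈ unitaryUnits (Matrix n n ℂ) := by
    rw [bseg]; exact hol_mem_of hUu _ _
  have hholU : hol (gaugeAct u₀ U) (((L : ℤ) ^ (k + 1)) • z) (seg i (M : ℤ)) ∈ unitaryUnits (Matrix n n ℂ) := hol_mem_of hEu _ _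
  have n1 : ∀ {u : (Matrix n n ℂ)ˣ}, u ∈ unitaryUnits (Matrix n n ℂ) → ‖(u : Matrix n n ℂ)‖ = 1 := fun hu =>
    CStarRing.norm_of_mem_unitary (mem_unitaryUnits.mp hu)
  -- `(hol E)⁻¹ u₀ bseg − u₀ = ((hol E)⁻¹ − 1) u₀ bseg + u₀ (bseg − 1)`
  set H : (Matrix n n ℂ)ˣ := hol (gaugeAct u₀ U) (((L : ℤ) ^ (k + 1)) • z) (seg i (M : ℤ)) with hHdef
  set B : (Matrix n n ℂ)ˣ := bseg M U z i with hBdef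
  set w₀ : (Matrix n n ℂ)ˣ := u₀ (((L : ℤ) ^ (k + 1)) • z) with hw₀
  have hid : (((H⁻¹ * w₀ * B : (Matrix n n ℂ)ˣ)) : Matrix n n ℂ) - (w₀ : Matrix n n ℂ)
      = ((((H⁻¹ : (Matrix n n ℂ)ˣ)) : Matrix n n ℂ) - 1) * (w₀ : Matrix n n ℂ) * (B : Matrix n n ℂ)
        + (w₀ : Matrix n n ℂ) * ((B : Matrix n n ℂ) - 1) := by
    simp only [Units.val_mul]; noncomm_ring
  rw [hsolve, hid]
  have hHinv : ‖(((H⁻¹ : (Matrix n n ℂ)ˣ)) : Matrix n n ℂ) - 1‖ ≤ (L : ℝ) ^ (k + 1) * (Real.exp a₀ - 1) := by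
    have e1 : (((H⁻¹ : (Matrix n n ℂ)ˣ)) : Matrix n n ℂ) - 1 = -((((H⁻¹ : (Matrix n n ℂ)ˣ)) : Matrix n n ℂ) * ((H : Matrix n n ℂ) - 1)) := by
      rw [mul_sub, mul_one, Units.inv_mul]; abel
    rw [e1, norm_neg, CStarRing.norm_mem_unitary_mul _ (mem_unitaryUnits.mp ((unitaryUnits _).inv_mem hholU))]
    exact hholE
  have hB := norm_bseg_sub_one_le_of_flatTop hL k hUu hx hs hUx hflatTopU z i
  refine (norm_add_le _ _).trans (add_le_add ?_ ?_)
  · rw [CStarRing.norm_mul_mem_unitary _ (mem_unitaryUnits.mp hbsegU), CStarRing.norm_mul_mem_unitary _ (mem_unitaryUnits.mp (hu₀ _))]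
    exact hHinv
  · rw [CStarRing.norm_mem_unitary_mul _ (mem_unitaryUnits.mp (hu₀ _))]
    rw [hBdef, hMdef]; exact hB

end

end Summit.QuantumFields.BalabanUV.T4Continuum.NE7CornerOscillationLetter
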